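import Summits.QuantumFields.BalabanUV.Beta.D1BFx.RestKernelSandwichUnit

/-!
# `BalabanUV.Beta.D1BFx.RestKernelSandwichSlot` — road «BF-x» for binder row D1, slot (K): **«SANDWICH SLOT PACK» — THE SANDWICH CROSS
# CHANNEL OF THE (K6c) SKELETON AS ONE MEMBER FAMILY `RkSand a 𝒱 𝒲 : Unit ⊕ (Bool × Bool) → ℕ → …` OF THE (K) SLOT, GENERIC IN THE PER-SCALE
# JETS, WITH ITS POINTWISE SUM (= PART 8's `legCross` WORD VERBATIM), ITS `hMR` ∕ `hRu` ∕ `hU` ROWS ON DISPLAYED n-UNIFORM JET LETTERS, AND ITS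
# n-FREE `hU₁` FRAGMENT** (OWNER INTENT I-d1p2-g18-9, PART 8 «(K6c) SKELETON»: «leaf-01 — the six rest words are your `Rk` wiring's members»; the
# pattern is «GHOST SLOT PACK» `RestKernelGhostSlot` p320733 ✓).

HONEST DEPENDENCY (cell records, verbatim): «continuum YM on T⁴ ⇐ BetaPertH ∧ nine spine estimates (0/9 proved); BetaPertH ⇐ (D1) ∧ (D4) ∧
CAP+tail; G-an2-4 gates asym, D1 and NE2/3/4.»  HONEST FRAMING (cell contract, verbatim): «discharging `BetaPertH` makes Bałaban's UV stability
UNCONDITIONAL — a real constructive-QFT result; it is NOT the continuum limit and NOT the Clay problem.»  THIS MODULE DISCHARGES NOTHING of the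
wall: [folklore] `dite` ∕ `Fintype.sum_sum_type` bookkeeping + the (1.22) read-out (`absMoment₂_of_decay510`, `secondMoment_abs_le_of_decay510`) of
«RK-SAND GENERIC-IN-JETS» `RestKernelSandwichUnit.exists_decay510_crossWord_road` (p318931 ✓) BY NAME, plus two [our object] DATA definitions (`RkSand`,
`CUsand`; asserting nothing).  Modulo the displayed [B5] hypotheses `h12` ∕ `h126` (the legs) and DISPLAYED n-UNIFORM JET LETTERS `σV mV κ mW` (the
per-scale first jets' centred weighted masses at the rate `σV∕n`, the per-scale second table's plain mass with the coarse decay `e^{−κ|z|₁}`) — which are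
HYPOTHESES: at the road's DRESSED pack `𝒱 n := vertexOfK G₀ n (SN (n−1) a S)` their n-uniformity is an OPEN (K) estimate, NOT claimed here (the loc letter
of record `AxialDressingRootedBmDress.locStencil_coProjBmAtK` carries `cKb' 3 n δ = cWb 3 n·e^{8δn}`).  No `def … : Prop`, no notation, nothing cited, 0 sorry.
0 root-level binders of row D1 discharged (hW ∕ hR-sockets ∕ hSX-socket ∕ D1Tel ∕ D1Rep — 0); (K) NOT closed; NOT D1, NOT `BetaPertH`, NOT continuum, NOT Clay.

ABSOLUTE RULE (cell charter, verbatim): «No internally-minted statement may enter as a cited fact. Every hypothesis is either kernel-proved in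
this package or a verbatim quotation of a PUBLISHED theorem with page reference. The manuscript(s) under audit are NOT citable for their own
disputed steps — they are the thing under adjudication; programme-internal (2001/route/tribunal) claims are never citable.»

THE SHAPES (the (K1) END `RoadEndBFxDictPointwiseS.hdict_of_pointwise` at `υ := Unit ⊕ (Bool × Bool)`, `Rk := RkSand a 𝒱 𝒲`): `hMR : ∀ u m, 1 ≤ m →
AbsMoment₂ (Rk u (Lc^m) μ ν)`; `hRu : ∀ u m, 1 ≤ m → |secondMoment (Rk u (Lc^m)) μ ν − Ru u (Lc^m)| ≤ CU′ u`; `hU₁ : Σ_u CU′ u ≤ U₁`; `hU : ∀ n, 2 ≤ n → ∀ u,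
|Ru u n| ≤ CU u`.  PART 8's word (at `n = m + 1`): `legCross ((2:ℝ)⁻¹ • Ga n a) ((−(2:ℝ)⁻¹) • blk (sandP n (Ga n a) (multM n (2a∕n⁸) 2)) true true) (ffV (𝒱 n)) (ffW (𝒲 n)) μ ν z`
with `𝒱 n = vertexOfK (coDressKBmAt (toSite r) n (KInvStep n 0)) n (SN m a S)`, `𝒲 n = 𝒲N∞` — the assembly's instantiation, not this file's.

CONTENT.
* §1 [our object] **`RkSand a 𝒱 𝒲 u n μ ν z`** := the sandwich cross word `crossWord (½•Ga n a) (−½•blk (sandP n …) tt) (ffV (𝒱 n)) (ffW (𝒲 n)) u μ ν z` for `n ≠ 0`,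
  `0` at the junk block size (`dite`, TOTAL in `n`); `RkSand_zero`, `RkSand_of_neZero`, `RkSand_succ`.
* §2 [folklore] the POINTWISE SUM: **`sum_RkSand_of_neZero`** ∕ `sum_RkSand_succ` (`Σ_u RkSand … u n μ ν z = legCross … (ffV (𝒱 n)) (ffW (𝒲 n)) μ ν z`, by
  `RestKernelWords.legCross_eq_sum_crossWord`), `sum_RkSand_zero`.
* §3 [our object] **`CUsand kG K c σV mV κ mW u`** (the n-free read-out constant per member: tadpole `½·(K∕2·mW)·M₂(κ)`, bubbles `½·(L̄_x·L̄_y·mV·mV)·M₂(min c σV)`,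
  `L̄_true = K∕2`, `L̄_false = kG∕2`, `M₂(r) := Σ'_x |x|₁² e^{−r|x|₁}`); [folklore] `CUsand_nonneg`, **`sum_CUsand`** (the lane's `hU₁` fragment in closed form).
* §4 [folklore] `mass_mono` (a centred weighted mass is monotone in the rate); [mod `h12 ∧ h126` + the displayed jet letters] **`exists_rows_RkSand`**: ONE n-free
  `kG, K ≥ 0`, `c > 0` with, for every `n ≥ 1` and every member, `AbsMoment₂` ∧ `|secondMoment| ≤ CUsand kG K c σV mV κ mW u`; **`exists_END_rows_RkSand`**: the
  same in the END's shapes at `n = Lc^m` — `hMR`, READING (b) `hRu` (`Ru := 0`, `CU′ := CUsand …`) with its vacuous `hU`, READING (a) `hRu` (`CU′ := 0`) ∕ `hU`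
  (`CU := CUsand …`).
NOT HERE (honest): the dressed pack's letters `σV mV κ mW` (open); the block lane (leaf-04), the FP word, `RJ2` ∕ `RJ3` ∕ `R₁₆` (OWNER ∕ an2 rulings); `hptw`;
any statement about `TshotOf`.
Unit `b2b-balaban-beta-d1-formalise-leaf-01` (gen 23), D1 formalisation swarm leaf prover 01, road «BF-x»; INTENT «SANDWICH SLOT PACK» (journal).
-/

noncomputable section

open Finset
open scoped BigOperators
open Literature.MathematicalPhysics.QuantumFieldTheory.Balaban1983to89
open Literature.MathematicalPhysics.QuantumFieldTheory.Balaban1983to89.Beta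
open B12Sec2to5 (l1 l1_nonneg Decay510 secondMoment_abs_le_of_decay510)
open DecimatedMomentSummable (AbsMoment₂ absMoment₂_of_decay510)
open ExpKernelCalculus (Site MKer decay510_mono_const)
open OneStepResolventKernel (Fib)
open VectorTailsLoc (fam kfam)
open Summit.QuantumFields.BalabanUV.Beta.D1BFx.PackedKernelSplit (blk ffV ffW legCross)
open Summit.QuantumFields.BalabanUV.Beta.D1BFx.CoarseGramInverse (multM)
open Summit.QuantumFields.BalabanUV.Beta.D1BFx.RWeightedLegPack (sandP)
open Summit.QuantumFields.BalabanUV.Beta.D1BFx.GluonLeg (Ga)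
open Summit.QuantumFields.BalabanUV.Beta.D1BFx.FrozenLegTails (nOf MOf hn1)
open Summit.QuantumFields.BalabanUV.Beta.D1BFx.RestKernelWords (crossWord legCross_eq_sum_crossWord)
open Summit.QuantumFields.BalabanUV.Beta.D1BFx.RestKernelSandwichUnit (exists_decay510_crossWord_road)

namespace Summit.QuantumFields.BalabanUV.Beta.D1BFx.RestKernelSandwichSlot

/-! ## §1 The sandwich members as a family TOTAL in the block size -/

/-- [our object] **THE SANDWICH FRAGMENT OF THE (K) SLOT**: `RkSand a 𝒱 𝒲 u n μ ν z` := the sandwich cross word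
`crossWord (½•Ga n a) (−½•blk (sandP n (Ga n a) (multM n (2a∕n⁸) 2)) tt) (ffV (𝒱 n)) (ffW (𝒲 n)) u μ ν z` of `RestKernelWords` over the road's split fine leg,
at the ff blocks of the PER-SCALE packed first jets `𝒱 n` and second tables `𝒲 n` (generic; the assembly's), for `n ≠ 0`, and `0` at the junk block size `n = 0`
— a `dite`, so that the family is TOTAL in `n` as the END's `Rk : υ → ℕ → …` requires.  A DEFINITION; asserts nothing. -/
def RkSand (a : ℝ) (𝒱 : ℕ → Fin 4 → Site 4 → MKer 4 (Fib 3)) (𝒲 : ℕ → Fin 4 → Site 4 → Fin 4 → Site 4 → MKer 4 (Fib 3))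
    (u : Unit ⊕ (Bool × Bool)) (n : ℕ) (μ ν : Fin 4) (z : Site 4) : ℝ :=
  if h : n = 0 then 0 else
    haveI : NeZero n := ⟨h⟩
    crossWord ((2 : ℝ)⁻¹ • Ga n a) ((-(2 : ℝ)⁻¹) • blk (sandP n (Ga n a) (multM n (2 * a / ((n : ℕ) : ℝ) ^ 8) 2)) true true)
      (ffV (𝒱 n)) (ffW (𝒲 n)) u μ ν z

variable (a : ℝ) (𝒱 : ℕ → Fin 4 → Site 4 → MKer 4 (Fib 3)) (𝒲 : ℕ → Fin 4 → Site 4 → Fin 4 → Site 4 → MKer 4 (Fib 3))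

/-- [our object] The junk value: at `n = 0` every member is the zero kernel. -/
theorem RkSand_zero (u : Unit ⊕ (Bool × Bool)) : RkSand a 𝒱 𝒲 u 0 = fun _ _ _ => 0 := by
  funext μ ν z
  simp [RkSand]

/-- [folklore] **AT ANY `[NeZero n]` THE MEMBER IS THE SANDWICH CROSS WORD** (the `dite` branch; the `NeZero n` instance manufactured inside the definition
and the ambient one are proofs of one `Prop`, hence the two sides agree definitionally). -/
theorem RkSand_of_neZero (u : Unit ⊕ (Bool × Bool)) (n : ℕ) [NeZero n] :
    RkSand a 𝒱 𝒲 u n = fun μ ν z => crossWord ((2 : ℝ)⁻¹ • Ga n a)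
      ((-(2 : ℝ)⁻¹) • blk (sandP n (Ga n a) (multM n (2 * a / ((n : ℕ) : ℝ) ^ 8) 2)) true true) (ffV (𝒱 n)) (ffW (𝒲 n)) u μ ν z := by
  funext μ ν z
  rw [RkSand, dif_neg (NeZero.ne n)]

/-- [folklore] … in PART 8's indexing `n := m + 1`. -/
theorem RkSand_succ (u : Unit ⊕ (Bool × Bool)) (m : ℕ) :
    RkSand a 𝒱 𝒲 u (m + 1) = fun μ ν z => crossWord ((2 : ℝ)⁻¹ • Ga (m + 1) a)
      ((-(2 : ℝ)⁻¹) • blk (sandP (m + 1) (Ga (m + 1) a) (multM (m + 1) (2 * a / ((m + 1 : ℕ) : ℝ) ^ 8) 2)) true true)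
      (ffV (𝒱 (m + 1))) (ffW (𝒲 (m + 1))) u μ ν z :=
  RkSand_of_neZero a 𝒱 𝒲 u (m + 1)

/-! ## §2 The pointwise sum: PART 8's `legCross` word -/

/-- [folklore] **THE SANDWICH LANE's CONTRIBUTION TO `Σ_u Rk u n μ ν z` AT ANY `[NeZero n]` IS THE CROSS CHANNEL** `legCross (½•Ga n a) (−½•blk (sandP n …) tt)
(ffV (𝒱 n)) (ffW (𝒲 n)) μ ν z` (`RestKernelWords.legCross_eq_sum_crossWord`) — what PART 8's «(K6c) SKELETON» displays as its first rest word. -/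
theorem sum_RkSand_of_neZero (n : ℕ) [NeZero n] (μ ν : Fin 4) (z : Site 4) :
    ∑ u : Unit ⊕ (Bool × Bool), RkSand a 𝒱 𝒲 u n μ ν z = legCross ((2 : ℝ)⁻¹ • Ga n a)
      ((-(2 : ℝ)⁻¹) • blk (sandP n (Ga n a) (multM n (2 * a / ((n : ℕ) : ℝ) ^ 8) 2)) true true) (ffV (𝒱 n)) (ffW (𝒲 n)) μ ν z := by
  rw [legCross_eq_sum_crossWord]
  exact Finset.sum_congr rfl fun u _ => by rw [RkSand_of_neZero]

/-- [folklore] … in PART 8's indexing `n := m + 1`, VERBATIM its `legCross` word at `𝒱 (m+1)`, `𝒲 (m+1)`. -/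
theorem sum_RkSand_succ (m : ℕ) (μ ν : Fin 4) (z : Site 4) :
    ∑ u : Unit ⊕ (Bool × Bool), RkSand a 𝒱 𝒲 u (m + 1) μ ν z = legCross ((2 : ℝ)⁻¹ • Ga (m + 1) a)
      ((-(2 : ℝ)⁻¹) • blk (sandP (m + 1) (Ga (m + 1) a) (multM (m + 1) (2 * a / ((m + 1 : ℕ) : ℝ) ^ 8) 2)) true true)
      (ffV (𝒱 (m + 1))) (ffW (𝒲 (m + 1))) μ ν z :=
  sum_RkSand_of_neZero a 𝒱 𝒲 (m + 1) μ ν z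

/-- [folklore] … and at the junk block size it is `0`. -/
theorem sum_RkSand_zero (μ ν : Fin 4) (z : Site 4) : ∑ u : Unit ⊕ (Bool × Bool), RkSand a 𝒱 𝒲 u 0 μ ν z = 0 :=
  Finset.sum_eq_zero fun u _ => by rw [RkSand_zero]

/-! ## §3 The n-free read-out constant per member and the lane's `hU₁` fragment -/

/-- [our object] **THE n-FREE READ-OUT CONSTANT PER MEMBER** in the letters `kG K c` of «RK-SAND GENERIC-IN-JETS» and the displayed jet letters `σV mV κ mW`:
tadpole `½·(K∕2·mW)·Σ'_x |x|₁² e^{−κ|x|₁}`; bubbles `½·(L̄_x·L̄_y·mV·mV)·Σ'_x |x|₁² e^{−(min c σV)|x|₁}`, `L̄_true = K∕2` (the sandwich leg's `K∕(2n²)` with the `n⁻²`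
DROPPED), `L̄_false = kG∕2` (the empty word `(false, false)` over-counted by the same formula).  A DEFINITION of a real number per member; asserts nothing. -/
def CUsand (kG K c σV mV κ mW : ℝ) : Unit ⊕ (Bool × Bool) → ℝ
  | Sum.inl _ => (1 / 2) * (K / 2 * mW) * ∑' x : Site 4, l1 x ^ 2 * Real.exp (-κ * l1 x)
  | Sum.inr (x, y) => (1 / 2) * ((bif x then K / 2 else kG / 2) * (bif y then K / 2 else kG / 2) * mV * mV)
      * ∑' w : Site 4, l1 w ^ 2 * Real.exp (-(min c σV) * l1 w)

/-- [our object] … on the tadpole member. -/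
theorem CUsand_inl (kG K c σV mV κ mW : ℝ) (u : Unit) :
    CUsand kG K c σV mV κ mW (Sum.inl u) = (1 / 2) * (K / 2 * mW) * ∑' x : Site 4, l1 x ^ 2 * Real.exp (-κ * l1 x) := rfl

/-- [our object] … on a bubble member. -/
theorem CUsand_inr (kG K c σV mV κ mW : ℝ) (x y : Bool) :
    CUsand kG K c σV mV κ mW (Sum.inr (x, y)) = (1 / 2) * ((bif x then K / 2 else kG / 2) * (bif y then K / 2 else kG / 2) * mV * mV)
      * ∑' w : Site 4, l1 w ^ 2 * Real.exp (-(min c σV) * l1 w) := rfl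

/-- [folklore] The moment majorant `Σ'_x |x|₁² e^{−r|x|₁}` is nonnegative (termwise). -/
theorem tsum_moment_nonneg (r : ℝ) : 0 ≤ ∑' x : Site 4, l1 x ^ 2 * Real.exp (-r * l1 x) :=
  tsum_nonneg fun _ => mul_nonneg (sq_nonneg _) (Real.exp_pos _).le

/-- [folklore] The read-out constants are nonnegative (`0 ≤ kG`, `0 ≤ K`, `0 ≤ mW`; `mV·mV` is a square). -/
theorem CUsand_nonneg {kG K c σV mV κ mW : ℝ} (hkG : 0 ≤ kG) (hK : 0 ≤ K) (hmW : 0 ≤ mW) :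
    ∀ u : Unit ⊕ (Bool × Bool), 0 ≤ CUsand kG K c σV mV κ mW u := by
  have hL : ∀ b : Bool, 0 ≤ (bif b then K / 2 else kG / 2) := fun b => by cases b <;> simp <;> positivity
  rintro (u | ⟨x, y⟩)
  · rw [CUsand_inl]
    exact mul_nonneg (by positivity) (tsum_moment_nonneg _)
  · rw [CUsand_inr]
    refine mul_nonneg (mul_nonneg (by norm_num) ?_) (tsum_moment_nonneg _)
    have : 0 ≤ mV * mV := mul_self_nonneg mV
    calc (0 : ℝ) = (bif x then K / 2 else kG / 2) * (bif y then K / 2 else kG / 2) * 0 := by ring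
      _ ≤ (bif x then K / 2 else kG / 2) * (bif y then K / 2 else kG / 2) * (mV * mV) :=
          mul_le_mul_of_nonneg_left this (mul_nonneg (hL x) (hL y))
      _ = _ := by ring

/-- [folklore] **THE LANE's `hU₁` FRAGMENT, EXACTLY**: `Σ_u CUsand … u` = the tadpole constant + `½·mV²·M₂(min c σV)·(K∕2 + kG∕2)²` — n-free. -/
theorem sum_CUsand (kG K c σV mV κ mW : ℝ) :
    ∑ u : Unit ⊕ (Bool × Bool), CUsand kG K c σV mV κ mW u
      = (1 / 2) * (K / 2 * mW) * (∑' x : Site 4, l1 x ^ 2 * Real.exp (-κ * l1 x))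
        + (1 / 2) * ((K / 2 + kG / 2) ^ 2 * mV * mV) * ∑' x : Site 4, l1 x ^ 2 * Real.exp (-(min c σV) * l1 x) := by
  simp only [Fintype.sum_sum_type, Fintype.sum_unique, Fintype.sum_prod_type, Fintype.sum_bool, CUsand_inl, CUsand_inr, cond_true, cond_false]
  ring

/-- [folklore] … as the inequality the END's `hU₁` binder displays (for the sandwich lane alone). -/
theorem sum_CUsand_le (kG K c σV mV κ mW : ℝ) :
    ∑ u : Unit ⊕ (Bool × Bool), CUsand kG K c σV mV κ mW u
      ≤ (1 / 2) * (K / 2 * mW) * (∑' x : Site 4, l1 x ^ 2 * Real.exp (-κ * l1 x))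
        + (1 / 2) * ((K / 2 + kG / 2) ^ 2 * mV * mV) * ∑' x : Site 4, l1 x ^ 2 * Real.exp (-(min c σV) * l1 x) :=
  le_of_eq (sum_CUsand kG K c σV mV κ mW)

/-! ## §4 The rows on displayed n-uniform jet letters (mod `h12 ∧ h126`) -/

/-- [folklore] **A CENTRED WEIGHTED MASS IS MONOTONE IN THE RATE**: `σ' ≤ σ` ⊢ summability and the value pass from the rate `σ` to the rate `σ'`
(any fibre, any centring offsets). -/
theorem mass_mono {F : Type*} [Fintype F] {V : MKer 4 F} {c₁ c₂ : Site 4} {σ σ' : ℝ} (hσ' : σ' ≤ σ)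
    (hs : Summable fun p : Site 4 × Site 4 => ∑ g, ∑ f, |V p.1 p.2 g f| * Real.exp (σ * (l1 (p.1 - c₁) + l1 (p.2 - c₂)))) :
    (Summable fun p : Site 4 × Site 4 => ∑ g, ∑ f, |V p.1 p.2 g f| * Real.exp (σ' * (l1 (p.1 - c₁) + l1 (p.2 - c₂)))) ∧
      ∑' p : Site 4 × Site 4, ∑ g, ∑ f, |V p.1 p.2 g f| * Real.exp (σ' * (l1 (p.1 - c₁) + l1 (p.2 - c₂)))
        ≤ ∑' p : Site 4 × Site 4, ∑ g, ∑ f, |V p.1 p.2 g f| * Real.exp (σ * (l1 (p.1 - c₁) + l1 (p.2 - c₂))) := by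
  have hle : ∀ p : Site 4 × Site 4, ∑ g, ∑ f, |V p.1 p.2 g f| * Real.exp (σ' * (l1 (p.1 - c₁) + l1 (p.2 - c₂)))
      ≤ ∑ g, ∑ f, |V p.1 p.2 g f| * Real.exp (σ * (l1 (p.1 - c₁) + l1 (p.2 - c₂))) := fun p =>
    Finset.sum_le_sum fun g _ => Finset.sum_le_sum fun f _ =>
      mul_le_mul_of_nonneg_left (Real.exp_le_exp.2
        (mul_le_mul_of_nonneg_right hσ' (add_nonneg (l1_nonneg _) (l1_nonneg _)))) (abs_nonneg _)
  have h0 : ∀ p : Site 4 × Site 4, 0 ≤ ∑ g, ∑ f, |V p.1 p.2 g f| * Real.exp (σ' * (l1 (p.1 - c₁) + l1 (p.2 - c₂))) :=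
    fun p => Finset.sum_nonneg fun g _ => Finset.sum_nonneg fun f _ => by positivity
  have hs' := Summable.of_nonneg_of_le h0 hle hs
  exact ⟨hs', hs'.tsum_le_tsum hle hs⟩

section Rows

variable {a : ℝ} (ha : 0 < a) {𝒱 : ℕ → Fin 4 → Site 4 → MKer 4 (Fib 3)} {𝒲 : ℕ → Fin 4 → Site 4 → Fin 4 → Site 4 → MKer 4 (Fib 3)}
  {σV mV κ mW : ℝ} {μ ν : Fin 4}
include ha

/-- [folklore] **THE ROWS OF THE SANDWICH LANE, EVERY BLOCK SIZE `n ≥ 1`** (mod [B5, Prop. 1.2] ∧ [B5, (1.126)–(1.127)] BY NAME, on the DISPLAYED n-uniform jet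
letters: `σV > 0`, the per-scale first jets' `σV∕n`-weighted centred masses `≤ mV`; `κ > 0`, the per-scale second table's plain mass at the channel `(μ, 0; ν, z)`
`≤ mW·e^{−κ|z|₁}`): ONE n-free triple `kG, K ≥ 0`, `c > 0` such that every member at every `n ≥ 1` has an absolutely summable second moment and
`|secondMoment (RkSand a 𝒱 𝒲 u n) μ ν| ≤ CUsand kG K c σV mV κ mW u` — «RK-SAND GENERIC-IN-JETS» at the jets' rate `min c σV ∕ n` (tadpoles at `κ`, bubbles at
`min c σV`, both n-free) read by (1.22), the sandwich leg's `n⁻²` dropped. -/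
theorem exists_rows_RkSand (h12 : B5.Prop12Printed (fam nOf hn1 MOf a ha)) (h126 : B5.Kernel126_127Printed (kfam nOf MOf))
    (hσV : 0 < σV)
    (hVs : ∀ (m : ℕ) (ρ : Fin 4) (y : Site 4), Summable fun p : Site 4 × Site 4 => ∑ g, ∑ f, |ffV (𝒱 (m + 1)) ρ y p.1 p.2 g f|
      * Real.exp (σV / ((m + 1 : ℕ) : ℝ) * (l1 (p.1 - ((m + 1 : ℕ) : ℤ) • y) + l1 (p.2 - ((m + 1 : ℕ) : ℤ) • y))))
    (hVm : ∀ (m : ℕ) (ρ : Fin 4) (y : Site 4), ∑' p : Site 4 × Site 4, ∑ g, ∑ f, |ffV (𝒱 (m + 1)) ρ y p.1 p.2 g f|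
      * Real.exp (σV / ((m + 1 : ℕ) : ℝ) * (l1 (p.1 - ((m + 1 : ℕ) : ℤ) • y) + l1 (p.2 - ((m + 1 : ℕ) : ℤ) • y))) ≤ mV)
    (hκ : 0 < κ)
    (hWs : ∀ (m : ℕ) (z : Site 4), Summable fun p : Site 4 × Site 4 => ∑ g, ∑ f, |ffW (𝒲 (m + 1)) μ 0 ν z p.1 p.2 g f|)
    (hWm : ∀ (m : ℕ) (z : Site 4), ∑' p : Site 4 × Site 4, ∑ g, ∑ f, |ffW (𝒲 (m + 1)) μ 0 ν z p.1 p.2 g f| ≤ mW * Real.exp (-κ * l1 z)) :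
    ∃ kG K c : ℝ, 0 < c ∧ 0 ≤ kG ∧ 0 ≤ K ∧ ∀ (u : Unit ⊕ (Bool × Bool)) (n : ℕ), 1 ≤ n →
      AbsMoment₂ (RkSand a 𝒱 𝒲 u n μ ν) ∧ |B12Beta.secondMoment (RkSand a 𝒱 𝒲 u n) μ ν| ≤ CUsand kG K c σV mV κ mW u := by
  obtain ⟨kG, K, c, hc, hkG, hK, hroad⟩ := exists_decay510_crossWord_road ha h12 h126
  refine ⟨kG, K, c, hc, hkG, hK, fun u n hn => ?_⟩
  obtain ⟨m, rfl⟩ : ∃ m, n = m + 1 := ⟨n - 1, (Nat.sub_add_cancel hn).symm⟩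
  have hn0 : (0 : ℝ) < ((m + 1 : ℕ) : ℝ) := by exact_mod_cast Nat.succ_pos m
  have hn1 : (1 : ℝ) ≤ ((m + 1 : ℕ) : ℝ) := by exact_mod_cast Nat.succ_le_succ (Nat.zero_le m)
  -- `0 ≤ mW` (the plain mass at `z = 0` is nonnegative and `≤ mW`)
  have hmW : 0 ≤ mW := by
    have h := hWm 0 0
    have e : l1 (0 : Site 4) = 0 := by simp [l1]
    rw [e, mul_zero, Real.exp_zero, mul_one] at h
    exact (tsum_nonneg fun p => Finset.sum_nonneg fun g _ => Finset.sum_nonneg fun f _ => abs_nonneg _).trans h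
  -- the jets' rate `σ := min c σV ∕ n`: below `c∕n` and below `σV∕n`
  set σ : ℝ := min c σV / ((m + 1 : ℕ) : ℝ) with hσdef
  have hmin0 : 0 < min c σV := lt_min hc hσV
  have hσ0 : 0 ≤ σ := by positivity
  have hσc : σ ≤ c / ((m + 1 : ℕ) : ℝ) := div_le_div_of_nonneg_right (min_le_left _ _) hn0.le
  have hσV' : σ ≤ σV / ((m + 1 : ℕ) : ℝ) := div_le_div_of_nonneg_right (min_le_right _ _) hn0.le
  have hV := fun ρ y => mass_mono (V := ffV (𝒱 (m + 1)) ρ y) hσV' (hVs m ρ y)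
  obtain ⟨hinl, hinr⟩ := hroad m (ffV (𝒱 (m + 1))) (ffW (𝒲 (m + 1))) σ mV mW κ μ ν hσ0 hσc
    (fun ρ y => (hV ρ y).1) (fun ρ y => (hV ρ y).2.trans (hVm m ρ y)) (hWs m) (hWm m)
  have e : σ * ((m + 1 : ℕ) : ℝ) = min c σV := div_mul_cancel₀ _ hn0.ne'
  rw [e] at hinr
  -- the sandwich leg's letter `K∕(2n²) ≤ K∕2`
  have hKn : K / 2 / (((m + 1 : ℕ) : ℝ)) ^ 2 ≤ K / 2 :=
    div_le_self (by positivity) (one_le_pow₀ hn1)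
  have hL : ∀ b : Bool, 0 ≤ (bif b then K / 2 / (((m + 1 : ℕ) : ℝ)) ^ 2 else kG / 2) ∧
      (bif b then K / 2 / (((m + 1 : ℕ) : ℝ)) ^ 2 else kG / 2) ≤ (bif b then K / 2 else kG / 2) := fun b => by
    cases b
    · exact ⟨by simp; positivity, by simp⟩
    · exact ⟨by simp; positivity, by simpa using hKn⟩
  rcases u with u | ⟨x, y⟩
  · -- the tadpole member: rate `κ`
    have hd : Decay510 (RkSand a 𝒱 𝒲 (Sum.inl u) (m + 1) μ ν) ((1 / 2) * (K / 2 * mW)) κ := by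
      rw [RkSand_succ]
      exact decay510_mono_const (hinl u) (by nlinarith [hKn, hmW])
    refine ⟨absMoment₂_of_decay510 hκ hd, ?_⟩
    rw [CUsand_inl]
    exact (secondMoment_abs_le_of_decay510 (P := RkSand a 𝒱 𝒲 (Sum.inl u) (m + 1)) hκ hd).2
  · -- a bubble member: rate `min c σV`
    have hprod : (bif x then K / 2 / (((m + 1 : ℕ) : ℝ)) ^ 2 else kG / 2) * (bif y then K / 2 / (((m + 1 : ℕ) : ℝ)) ^ 2 else kG / 2) * mV * mV
        ≤ (bif x then K / 2 else kG / 2) * (bif y then K / 2 else kG / 2) * mV * mV := by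
      have hsq : 0 ≤ mV * mV := mul_self_nonneg mV
      have h1 := mul_le_mul (hL x).2 (hL y).2 (hL y).1 ((hL x).1.trans (hL x).2)
      calc _ = ((bif x then K / 2 / (((m + 1 : ℕ) : ℝ)) ^ 2 else kG / 2) * (bif y then K / 2 / (((m + 1 : ℕ) : ℝ)) ^ 2 else kG / 2)) * (mV * mV) := by
            ring
        _ ≤ ((bif x then K / 2 else kG / 2) * (bif y then K / 2 else kG / 2)) * (mV * mV) := mul_le_mul_of_nonneg_right h1 hsq
        _ = _ := by ring
    have hd : Decay510 (RkSand a 𝒱 𝒲 (Sum.inr (x, y)) (m + 1) μ ν)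
        ((1 / 2) * ((bif x then K / 2 else kG / 2) * (bif y then K / 2 else kG / 2) * mV * mV)) (min c σV) := by
      rw [RkSand_succ]
      exact decay510_mono_const (hinr x y) (by linarith)
    refine ⟨absMoment₂_of_decay510 hmin0 hd, ?_⟩
    rw [CUsand_inr]
    exact (secondMoment_abs_le_of_decay510 (P := RkSand a 𝒱 𝒲 (Sum.inr (x, y)) (m + 1)) hmin0 hd).2

/-- [folklore] **THE SANDWICH LANE's ROWS IN THE END's SHAPES** (`RoadEndBFxDictPointwiseS.hdict_of_pointwise` ∕ `…d1Rep…ptw…` at `υ := Unit ⊕ (Bool × Bool)`,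
`Rk := RkSand a 𝒱 𝒲`, any `[NeZero Lc]`; mod `h12 ∧ h126` + the displayed jet letters): ONE n-free `kG, K ≥ 0`, `c > 0` with
(i) `hMR`: `∀ u m, 1 ≤ m → AbsMoment₂ (RkSand … u (Lc^m) μ ν)`; (ii) READING (b) (the one the JOINT ROOT consumes): `hRu` with `Ru := 0`, `CU′ := CUsand …`
(its `hU` row `|0| ≤ 0` is vacuous); (iii) READING (a): `hRu` with `Ru := secondMoment`, `CU′ := 0`, and `hU` with `CU := CUsand …` at every `n ≥ 2`;
(iv) the n-uniform unit row at every `n ≥ 1`.  The `hU₁` fragment is `sum_CUsand(_le)`. -/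
theorem exists_END_rows_RkSand {Lc : ℕ} [NeZero Lc] (h12 : B5.Prop12Printed (fam nOf hn1 MOf a ha))
    (h126 : B5.Kernel126_127Printed (kfam nOf MOf)) (hσV : 0 < σV)
    (hVs : ∀ (m : ℕ) (ρ : Fin 4) (y : Site 4), Summable fun p : Site 4 × Site 4 => ∑ g, ∑ f, |ffV (𝒱 (m + 1)) ρ y p.1 p.2 g f|
      * Real.exp (σV / ((m + 1 : ℕ) : ℝ) * (l1 (p.1 - ((m + 1 : ℕ) : ℤ) • y) + l1 (p.2 - ((m + 1 : ℕ) : ℤ) • y))))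
    (hVm : ∀ (m : ℕ) (ρ : Fin 4) (y : Site 4), ∑' p : Site 4 × Site 4, ∑ g, ∑ f, |ffV (𝒱 (m + 1)) ρ y p.1 p.2 g f|
      * Real.exp (σV / ((m + 1 : ℕ) : ℝ) * (l1 (p.1 - ((m + 1 : ℕ) : ℤ) • y) + l1 (p.2 - ((m + 1 : ℕ) : ℤ) • y))) ≤ mV)
    (hκ : 0 < κ)
    (hWs : ∀ (m : ℕ) (z : Site 4), Summable fun p : Site 4 × Site 4 => ∑ g, ∑ f, |ffW (𝒲 (m + 1)) μ 0 ν z p.1 p.2 g f|)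
    (hWm : ∀ (m : ℕ) (z : Site 4), ∑' p : Site 4 × Site 4, ∑ g, ∑ f, |ffW (𝒲 (m + 1)) μ 0 ν z p.1 p.2 g f| ≤ mW * Real.exp (-κ * l1 z)) :
    ∃ kG K c : ℝ, 0 < c ∧ 0 ≤ kG ∧ 0 ≤ K ∧
      -- (i) `hMR`
      (∀ (u : Unit ⊕ (Bool × Bool)) (m : ℕ), 1 ≤ m → AbsMoment₂ (RkSand a 𝒱 𝒲 u (Lc ^ m) μ ν)) ∧
      -- (ii) READING (b): `hRu` with `Ru := 0`, `CU′ := CUsand …`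
      (∀ (u : Unit ⊕ (Bool × Bool)) (m : ℕ), 1 ≤ m →
        |B12Beta.secondMoment (RkSand a 𝒱 𝒲 u (Lc ^ m)) μ ν - (fun (_ : Unit ⊕ (Bool × Bool)) (_ : ℕ) => (0 : ℝ)) u (Lc ^ m)|
          ≤ CUsand kG K c σV mV κ mW u) ∧
      -- (iii) READING (a): `hRu` with `CU′ := 0` and `hU` with `CU := CUsand …`
      (∀ (u : Unit ⊕ (Bool × Bool)) (m : ℕ), 1 ≤ m →
        |B12Beta.secondMoment (RkSand a 𝒱 𝒲 u (Lc ^ m)) μ ν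
          - (fun (u : Unit ⊕ (Bool × Bool)) (n : ℕ) => B12Beta.secondMoment (RkSand a 𝒱 𝒲 u n) μ ν) u (Lc ^ m)| ≤ (fun _ : Unit ⊕ (Bool × Bool) => (0 : ℝ)) u) ∧
      (∀ n : ℕ, 2 ≤ n → ∀ u : Unit ⊕ (Bool × Bool),
        |(fun (u : Unit ⊕ (Bool × Bool)) (n : ℕ) => B12Beta.secondMoment (RkSand a 𝒱 𝒲 u n) μ ν) u n| ≤ CUsand kG K c σV mV κ mW u) ∧
      -- (iv) the n-uniform unit row
      (∀ (u : Unit ⊕ (Bool × Bool)) (n : ℕ), 1 ≤ n → |B12Beta.secondMoment (RkSand a 𝒱 𝒲 u n) μ ν| ≤ CUsand kG K c σV mV κ mW u) := by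
  obtain ⟨kG, K, c, hc, hkG, hK, hrows⟩ := exists_rows_RkSand ha h12 h126 hσV hVs hVm hκ hWs hWm
  have hLm : ∀ m : ℕ, 1 ≤ Lc ^ m := fun m => Nat.one_le_pow _ _ (Nat.pos_of_ne_zero (NeZero.ne Lc))
  refine ⟨kG, K, c, hc, hkG, hK, fun u m _ => (hrows u (Lc ^ m) (hLm m)).1, fun u m _ => ?_, fun u m _ => ?_, fun n hn u => ?_,
    fun u n hn => (hrows u n hn).2⟩
  · rw [sub_zero]
    exact (hrows u (Lc ^ m) (hLm m)).2
  · rw [sub_self, abs_zero]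
  · exact (hrows u n ((Nat.le_succ 1).trans hn)).2

end Rows

end Summit.QuantumFields.BalabanUV.Beta.D1BFx.RestKernelSandwichSlot

end
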